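import Summits.QuantumFields.YangMills.Theorems.BalabanLadderUVSeamRecTorusPeeling
import Summits.QuantumFields.YangMills.Theorems.BalabanLadderUVSeamRecClassicalResponseThermalCeiling
import Summits.QuantumFields.BalabanUV.InfraRed.StrongCouplingForestHolonomyGauge
import HarnessLib

/-!
# Crux `UVSeamRec` (stmt-QuantumFields-20043), Tier 2 of the torus thermal ceiling: the forest-gauge LOWER bound on the partition function,
# the chord `[β/2, β]`, and the TORUS THERMAL CEILING WITHOUT THE LOG — `⟨2 − plane⟩_{2L+1,β} ≤ 27/β + 2 log β/((2L+1)β)`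

Helper file (`--supports stmt-QuantumFields-20043`) of the LEAD seat `ym-spine-20043-p1` (gen 11); sizing of record tempered-d1 g5
`MEMO-D1-g5-coldwall-ceiling.md` §Tier 2 (director-ym R395); sequel of `…TorusLaplaceSU2` (sharp small ball `r³/600`, one-plaquette Laplace `3/(b√b)`)
and `…TorusPeeling` (upper bound `∫ e^{−bS} dHaar^E ≤ (3/(b√b))^{3(M⁴ − M³)}`).
* §1 the TEMPORAL COMB: the time-like links `(x, 3)` with `x₃ ≠ −1` form a ranked forest of cardinality `M⁴ − M³` (`isRankedForest_temporalComb`);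
* §2 **`integral_exp_neg_mul_wilsonAction_ge_frozen`** — every compact second-countable `G`, continuous unitary `ρ`, ranked forest `F`, `β ≥ 0`, `r > 0`:
  `exp(−8βr²·#P) · φ_ρ(r)^{#E − #F} ≤ ∫ e^{−βS} dHaar^E` (the tree's forest gauge fixing `StrongCouplingForestHolonomyGauge.integral_pi_eq_integral_frozenHaar`,
  then restriction of the free links to the Frobenius ball of radius `r`, where every plaquette costs `≤ 8r²`; `φ_ρ(r) = Haar{‖ρ g − 1‖_F ≤ r}`);
* §3 **`wilsonExpectation_two_sub_trace_le_su2`** — for `SU(2)` (fundamental, tree units `β = β_W/2`), every `β ≥ 2` and every four-torus of side `M ≥ 2`: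
  `⟨2 − Re tr U_p⟩_{Λ_M,β} ≤ 27/β + 2 log β/(M β)` — chord `[β/2, β]` of the convex `log Z` (`WilsonEnergyConvexity.mul_wilsonExpectation_wilsonAction_le`),
  peeling upper bound at `β/2` (`3(M⁴ − M³)` electric plaquettes), temporal-comb lower bound at `β` with `r = β^{−1/2}` (`3M⁴ + M³` free links): the
  `(3/2)·#dof·log β` terms CANCEL up to `4M³` links, which leave the residual `2 log β/(Mβ)`; crux letters `torusE_two_sub_plane_le_sharp`
  (`⟨plane q x⟩_{2L+1,β} ≥ 2 − 27/β − 2 log β/((2L+1)β)`, `β ≥ 2`, `L ≥ 1`) and `torusE_two_sub_plane_le_of_log_le` (`≥ 2 − 29/β` when `2L+1 ≥ log β`).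
The Θ(1/β) two-sided pin of the (RM) reference follows in the sequel `…TorusCeilingPinning`.  HONEST FRAMING: an elementary, volume-explicit two-sided
Laplace estimate of the torus free energy; nothing of E0′, NT or the gap; not Clay.
-/

open MeasureTheory Finset Function
open scoped ENNReal Matrix Matrix.Norms.Frobenius
open Literature.MathematicalPhysics.QuantumFieldTheory
open Literature.MathematicalPhysics.QuantumLattice (fundamentalRep fundamentalRep_mem_unitaryGroup continuous_fundamentalRep
  secondCountableTopology_su2 fundamentalLatticeRep LGConfig)
open Summit.QuantumFields.BalabanUV.InfraRed.StrongCouplingForestGauge (IsRankedForest upperEnd)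
open Summit.QuantumFields.BalabanUV.InfraRed.StrongCouplingForestGaugeFixing (frozenHaar)
open Summit.QuantumFields.BalabanUV.InfraRed.StrongCouplingForestHolonomyShear (holonomyFix)
open Summit.QuantumFields.BalabanUV.InfraRed.StrongCouplingForestHolonomyGauge (integral_pi_eq_integral_frozenHaar)
open Summit.QuantumFields.YangMills.Cruxes.OSLegsFromFemtoAndGap.DlrCollarTransfer

noncomputable section

namespace Summit.QuantumFields.YangMills.Cruxes.UVSeamRec.ClassicalResponse.ThermalFloor

/-! ### §1 The temporal comb -/

section Comb

variable {M : ℕ} [NeZero M]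

/-- **The temporal comb is a ranked forest**: the time-like links `(x, 3)` with `x₃ ≠ −1`, ranked by `val x₃` (the rank increases by one along each
such link, and the upper ends `x + e₃` are pairwise distinct). [folklore] -/
theorem isRankedForest_temporalComb [Fact (1 < M)] :
    IsRankedForest ((univ.filter fun x : Site 4 M => x 3 ≠ -1).image (fun x => ((x, (3 : Fin 4)) : Edge 4 M)))
      (fun x : Site 4 M => (x 3).val) := by
  classical
  constructor
  · intro e he
    simp only [mem_image, mem_filter, mem_univ, true_and] at he
    obtain ⟨x, hx, rfl⟩ := he
    show (x 3).val ≠ ((x.shift 3) 3).val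
    rw [val_apply_three_shift hx]
    exact (Nat.lt_succ_self _).ne
  · intro e he e' he' h
    simp only [coe_image, coe_filter, mem_univ, true_and, Set.mem_image, Set.mem_setOf_eq] at he he'
    obtain ⟨x, hx, rfl⟩ := he
    obtain ⟨x', hx', rfl⟩ := he'
    have hu : ∀ {y : Site 4 M}, y 3 ≠ -1 → upperEnd (fun z : Site 4 M => (z 3).val) ((y, (3 : Fin 4)) : Edge 4 M) = y.shift 3 := by
      intro y hy
      unfold upperEnd
      rw [if_neg (by show ¬ ((y.shift 3) 3).val < (y 3).val; rw [val_apply_three_shift hy]; omega)]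
    rw [hu hx, hu hx'] at h
    have := congrArg (fun z : Site 4 M => z - Pi.single (3 : Fin 4) 1) h
    rw [show x = x' by simpa [Site.shift] using this]

/-- The temporal comb has `M⁴ − M³` links. [folklore] -/
theorem card_temporalComb :
    ((univ.filter fun x : Site 4 M => x 3 ≠ -1).image (fun x => ((x, (3 : Fin 4)) : Edge 4 M))).card = M ^ 4 - M ^ 3 := by
  classical
  rw [card_image_of_injective _ (fun x x' h => (Prod.mk.inj h).1)]
  exact card_sites_apply_three_ne

/-- `#E = 4M⁴` links on the four-torus of side `M`. [folklore] -/
theorem card_edge_four : Fintype.card (Edge 4 M) = 4 * M ^ 4 := by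
  rw [Fintype.card_prod, Fintype.card_fun, ZMod.card, Fintype.card_fin]; ring

/-- `#P = 6M⁴` plaquettes on the four-torus of side `M`. [folklore] -/
theorem card_plaquette_four : Fintype.card (Plaquette 4 M) = 6 * M ^ 4 := by
  have h6 : Fintype.card {p : Fin 4 × Fin 4 // p.1 < p.2} = 6 := by decide
  rw [Fintype.card_prod, Fintype.card_fun, ZMod.card, Fintype.card_fin, h6]; ring

end Comb

/-! ### §2 The forest-gauge lower bound on the partition function -/

section Lower

variable {d L N : ℕ} [NeZero L] {G : Type*} [Group G] [TopologicalSpace G] [IsTopologicalGroup G] [CompactSpace G]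
  [MeasurableSpace G] [BorelSpace G] [SecondCountableTopology G] (ρ : G →* Matrix (Fin N) (Fin N) ℂ)

/-- **FOREST-GAUGE LOWER BOUND ON THE TORUS PARTITION FUNCTION.**  For a compact second-countable `G`, a continuous unitary representation `ρ`, a ranked
link forest `F` of the torus `(ℤ/L)^d`, `β ≥ 0` and `r > 0`:
`exp(−8βr²·#P) · φ_ρ(r)^{#E − #F} ≤ ∫ exp(−β S) dHaar^E`, `φ_ρ(r) = Haar{g : ‖ρ g − 1‖_F ≤ r}` — gauge-fix the forest links to `1`
(`integral_pi_eq_integral_frozenHaar`, the Wilson weight being gauge invariant), then keep only the configurations whose free links lie in the Frobenius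
ball of radius `r`, on which every plaquette costs at most `8r²` (`wilsonAction_le_of_forall_norm_le`). [folklore] -/
theorem integral_exp_neg_mul_wilsonAction_ge_frozen (hρ : Continuous ρ) (hρU : ∀ g, ρ g ∈ Matrix.unitaryGroup (Fin N) ℂ)
    {F : Finset (Edge d L)} {rk : Site d L → ℕ} (hF : IsRankedForest F rk) {β : ℝ} (hβ : 0 ≤ β) {r : ℝ} (hr : 0 < r) :
    Real.exp (-(8 * β * r ^ 2 * Fintype.card (Plaquette d L))) *
        (haarProbability G).real {g : G | ‖ρ g - 1‖ ≤ r} ^ (Fintype.card (Edge d L) - F.card) ≤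
      ∫ U, Real.exp (-β * wilsonAction ρ U) ∂(Measure.pi fun _ : Edge d L => haarProbability G) := by
  classical
  -- the frozen a-priori measure and its factors
  let μF : Edge d L → Measure G := fun e => if e ∈ F then Measure.dirac (1 : G) else haarProbability G
  haveI hprob : IsProbabilityMeasure (haarProbability G) :=
    ⟨by simpa [haarProbability] using Measure.haarMeasure_self (G := G) (K₀ := ⊤)⟩
  haveI : ∀ e, IsProbabilityMeasure (μF e) := fun e => by
    dsimp only [μF]; split_ifs <;> infer_instance
  haveI : IsProbabilityMeasure (frozenHaar (G := G) F) := by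
    show IsProbabilityMeasure (Measure.pi μF); infer_instance
  -- gauge fixing: `∫ e^{−βS} dHaar^E = ∫ e^{−βS} d(frozenHaar F)`
  have hfix : ∀ U : GaugeConfig d L G, Real.exp (-β * wilsonAction ρ (holonomyFix F rk U)) = Real.exp (-β * wilsonAction ρ U) := by
    intro U; simp only [holonomyFix, wilsonAction_gaugeTransform]
  have hgauge := integral_pi_eq_integral_frozenHaar (G := G) hF hfix (integrable_exp_mul_wilsonAction ρ hρ (-β) _)
  rw [hgauge]
  -- the link ball and the action bound on it
  set Ball : Set G := {g : G | ‖ρ g - 1‖ ≤ r} with hBall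
  have hBallm : MeasurableSet Ball :=
    (isClosed_le ((continuous_norm.comp (hρ.sub continuous_const))) continuous_const).measurableSet
  set A : Set (GaugeConfig d L G) := Set.pi Set.univ fun _ : Edge d L => Ball with hA
  have hAm : MeasurableSet A := MeasurableSet.univ_pi fun _ => hBallm
  set ε : ℝ := 8 * r ^ 2 * Fintype.card (Plaquette d L) with hε
  have hSA : ∀ U ∈ A, wilsonAction ρ U ≤ ε := by
    intro U hU
    have hU' : ∀ e, ‖ρ (U e) - 1‖ ≤ r := fun e => by
      have := hU e (Set.mem_univ e); exact this
    exact wilsonAction_le_of_forall_norm_le ρ hρU hU'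
  -- `∫ e^{−βS} d(frozenHaar) ≥ e^{−βε} · frozenHaar(A)`
  have hlow : Real.exp (-β * ε) * (frozenHaar (G := G) F).real A ≤
      ∫ U, Real.exp (-β * wilsonAction ρ U) ∂(frozenHaar (G := G) F) := by
    have hind : ∫ U, A.indicator (fun _ => Real.exp (-β * ε)) U ∂(frozenHaar (G := G) F) =
        Real.exp (-β * ε) * (frozenHaar (G := G) F).real A := by
      rw [integral_indicator_const _ hAm, smul_eq_mul, mul_comm]
    rw [← hind]
    refine integral_mono ((integrable_const _).indicator hAm) (integrable_exp_mul_wilsonAction ρ hρ (-β) _) fun U => ?_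
    by_cases hU : U ∈ A
    · rw [Set.indicator_of_mem hU]
      refine Real.exp_le_exp.2 ?_
      have := hSA U hU
      nlinarith
    · rw [Set.indicator_of_notMem hU]
      exact (Real.exp_pos _).le
  -- `frozenHaar(A) = φ^{#E − #F}`
  have h1Ball : (1 : G) ∈ Ball := by
    show ‖ρ 1 - 1‖ ≤ r
    rw [map_one, sub_self, norm_zero]; exact hr.le
  have hmeasA : (frozenHaar (G := G) F) A = ENNReal.ofReal ((haarProbability G).real Ball) ^ (Fintype.card (Edge d L) - F.card) := by
    show Measure.pi μF A = _
    rw [hA, Measure.pi_pi]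
    have hfac : ∀ e, μF e Ball = if e ∈ F then 1 else ENNReal.ofReal ((haarProbability G).real Ball) := by
      intro e
      dsimp only [μF]
      split_ifs with he
      · exact Measure.dirac_apply_of_mem h1Ball
      · rw [ofReal_measureReal]
    simp_rw [hfac]
    rw [Finset.prod_ite, Finset.prod_const_one, one_mul, Finset.prod_const]
    congr 1
    have hF' : (univ.filter fun e : Edge d L => e ∈ F) = F := by ext e; simp
    have := Finset.card_filter_add_card_filter_not (s := (univ : Finset (Edge d L))) (fun e : Edge d L => e ∈ F)
    rw [hF', Finset.card_univ] at this
    omega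
  have hrealA : (frozenHaar (G := G) F).real A = (haarProbability G).real Ball ^ (Fintype.card (Edge d L) - F.card) := by
    rw [measureReal_def, hmeasA, ← ENNReal.ofReal_pow measureReal_nonneg, ENNReal.toReal_ofReal (pow_nonneg measureReal_nonneg _)]
  rw [hrealA] at hlow
  rwa [show -β * ε = -(8 * β * r ^ 2 * Fintype.card (Plaquette d L)) by rw [hε]; ring] at hlow

end Lower

/-! ### §3 The torus thermal ceiling without the log -/

section Ceiling

/-- `log 600 ≤ 13/2` (`600 ≤ e^{6.5}`, from `e > 2.71828` and `e^{1/2} ≥ 3/2`). [folklore] -/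
private theorem log_600_le : Real.log 600 ≤ 13 / 2 := by
  rw [Real.log_le_iff_le_exp (by norm_num)]
  have he : (2.71828 : ℝ) < Real.exp 1 := lt_trans (by norm_num) Real.exp_one_gt_d9
  have h6 : Real.exp (13 / 2) = Real.exp 1 ^ 6 * Real.exp (1 / 2) := by
    rw [← Real.exp_nat_mul, ← Real.exp_add]; norm_num
  have h25 : (1 : ℝ) + 1 / 2 ≤ Real.exp (1 / 2) := by
    have := Real.add_one_le_exp (1 / 2 : ℝ); linarith
  have hp : (2.71828 : ℝ) ^ 6 < Real.exp 1 ^ 6 := by gcongr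
  have h403 : (403 : ℝ) < Real.exp 1 ^ 6 := lt_trans (by norm_num) hp
  rw [h6]
  nlinarith [Real.exp_pos (1 / 2 : ℝ), h403, h25]

/-- `log 3 ≤ 7/5`. [folklore] -/
private theorem log_three_le' : Real.log 3 ≤ 7 / 5 := by
  have h1 : Real.log 3 ≤ Real.log 4 := Real.log_le_log (by norm_num) (by norm_num)
  have h2 : Real.log 4 = 2 * Real.log 2 := by
    rw [show (4 : ℝ) = 2 ^ 2 by norm_num, Real.log_pow]; norm_num
  linarith [Real.log_two_lt_d9]

/-- **THE TORUS THERMAL CEILING WITHOUT THE LOG (`SU(2)`, explicit, every volume).**  For the defining representation of `SU(2)` (tree units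
`β = β_W/2`), every `β ≥ 2` and every four-torus `(ℤ/M)⁴` with `M ≥ 2`, every site `x` and axes `i ≠ j`:
`⟨2 − Re tr U_{x,ij}⟩_{Λ_M,β} ≤ 27/β + 2 log β/(M β)`.
Proof: the chord `[β/2, β]` of the convex `log Z` (`(β/2)⟨S⟩_β ≤ log Z(β/2) − log Z(β)`), the peeling upper bound
`log Z(β/2) ≤ 3(M⁴ − M³) log(3(β/2)^{−3/2})` and the temporal-comb lower bound `log Z(β) ≥ −48M⁴ + (3M⁴ + M³) log(β^{−3/2}/600)`: the `log β` terms
cancel up to `6M³ log β`, and `⟨S⟩_β = 6M⁴ ⟨2 − Re tr U_p⟩`. [folklore] -/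
theorem wilsonExpectation_two_sub_trace_le_su2 {M : ℕ} [NeZero M] [Fact (1 < M)] {β : ℝ} (hβ : 2 ≤ β)
    (x : Site 4 M) {i j : Fin 4} (hij : i ≠ j) :
    wilsonExpectation (fundamentalRep (Fin 2)) β
        (fun U : GaugeConfig 4 M (Matrix.specialUnitaryGroup (Fin 2) ℂ) =>
          ((2 : ℕ) : ℝ) - (fundamentalRep (Fin 2) (plaquetteHolonomy U x i j)).trace.re) ≤
      27 / β + 2 * Real.log β / (M * β) := by
  haveI : SecondCountableTopology (Matrix.specialUnitaryGroup (Fin 2) ℂ) := secondCountableTopology_su2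
  set ρ := fundamentalRep (Fin 2) with hρdef
  have hρ : Continuous ρ := continuous_fundamentalRep (Fin 2)
  have hρU : ∀ g, ρ g ∈ Matrix.unitaryGroup (Fin 2) ℂ := fundamentalRep_mem_unitaryGroup
  have hβ0 : 0 < β := by linarith
  have hβ1 : 1 ≤ β := by linarith
  have hlogβ : 0 ≤ Real.log β := Real.log_nonneg hβ1
  set Mr : ℝ := (M : ℝ) with hMr
  have hM1 : (2 : ℝ) ≤ Mr := by rw [hMr]; exact_mod_cast (Fact.out : 1 < M)
  have hM0 : 0 < Mr := by linarith
  -- the partition integrals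
  set ZI : ℝ → ℝ := fun b => ∫ U, Real.exp (-b * wilsonAction ρ U)
    ∂(Measure.pi fun _ : Edge 4 M => haarProbability (Matrix.specialUnitaryGroup (Fin 2) ℂ)) with hZI
  have hZpos : ∀ b, 0 < ZI b := fun b => integral_exp_neg_mul_wilsonAction_pos ρ hρ b
  -- chord `[β/2, β]`
  have hchord := mul_wilsonExpectation_wilsonAction_le (d := 4) (L := M) (G := Matrix.specialUnitaryGroup (Fin 2) ℂ) ρ hρ β (β / 2)
  rw [torusLogPartition_eq_log_integral ρ hρ, torusLogPartition_eq_log_integral ρ hρ] at hchord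
  change (β - β / 2) * _ ≤ Real.log (ZI (β / 2)) - Real.log (ZI β) at hchord
  -- UPPER bound at `β/2`
  have hb : 0 < β / 2 := by linarith
  have hup0 := integral_exp_neg_mul_wilsonAction_le_su2 (M := M) hb
  have hcnt : ((M ^ 4 - M ^ 3 : ℕ) : ℝ) = Mr ^ 4 - Mr ^ 3 := by
    have hle : M ^ 3 ≤ M ^ 4 := Nat.pow_le_pow_right (NeZero.pos M) (by norm_num)
    rw [Nat.cast_sub hle]; push_cast; rw [hMr]
  have hψpos : 0 < 3 / (β / 2 * Real.sqrt (β / 2)) := by positivity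
  have hup : Real.log (ZI (β / 2)) ≤ 3 * (Mr ^ 4 - Mr ^ 3) * (Real.log 3 - 3 / 2 * Real.log (β / 2)) := by
    have h1 : Real.log (ZI (β / 2)) ≤ Real.log ((3 / (β / 2 * Real.sqrt (β / 2))) ^ (3 * (M ^ 4 - M ^ 3))) :=
      Real.log_le_log (hZpos _) hup0
    rw [Real.log_pow] at h1
    have h2 : Real.log (3 / (β / 2 * Real.sqrt (β / 2))) = Real.log 3 - 3 / 2 * Real.log (β / 2) := by
      rw [Real.log_div (by norm_num) (by positivity), Real.log_mul hb.ne' (Real.sqrt_pos.2 hb).ne', Real.log_sqrt hb.le]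
      ring
    rw [h2] at h1
    have h3 : ((3 * (M ^ 4 - M ^ 3) : ℕ) : ℝ) = 3 * (Mr ^ 4 - Mr ^ 3) := by push_cast [Nat.cast_mul]; rw [hcnt]
    rw [h3] at h1
    exact h1
  -- LOWER bound at `β` in the temporal-comb gauge with `r = β^{-1/2}`
  set r : ℝ := Real.sqrt (1 / β) with hr
  have hr0 : 0 < r := Real.sqrt_pos.2 (by positivity)
  have hr2 : r ^ 2 = 1 / β := by rw [hr, Real.sq_sqrt (by positivity)]
  have hr1 : r ≤ 1 := by
    rw [hr, Real.sqrt_le_left zero_le_one, one_pow, div_le_one hβ0]; exact hβ1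
  have hφ := haarProbability_real_frobeniusBall_ge_su2_sharp hr0 hr1
  have hlow0 := integral_exp_neg_mul_wilsonAction_ge_frozen (d := 4) (L := M) ρ hρ hρU (isRankedForest_temporalComb (M := M)) hβ0.le hr0
  rw [card_temporalComb, card_edge_four, card_plaquette_four] at hlow0
  have hfree : 4 * M ^ 4 - (M ^ 4 - M ^ 3) = 3 * M ^ 4 + M ^ 3 := by
    have hle : M ^ 3 ≤ M ^ 4 := Nat.pow_le_pow_right (NeZero.pos M) (by norm_num)
    omega
  rw [hfree] at hlow0
  set φ : ℝ := (haarProbability (Matrix.specialUnitaryGroup (Fin 2) ℂ)).real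
    {g : Matrix.specialUnitaryGroup (Fin 2) ℂ | ‖ρ g - 1‖ ≤ r} with hφdef
  have hφpos : 0 < φ := lt_of_lt_of_le (by positivity) hφ
  have hlow : -(48 * Mr ^ 4) + (3 * Mr ^ 4 + Mr ^ 3) * (3 * Real.log r - Real.log 600) ≤ Real.log (ZI β) := by
    have h1 : Real.log (Real.exp (-(8 * β * r ^ 2 * ((6 * M ^ 4 : ℕ) : ℝ))) * φ ^ (3 * M ^ 4 + M ^ 3)) ≤ Real.log (ZI β) :=
      Real.log_le_log (mul_pos (Real.exp_pos _) (pow_pos hφpos _)) hlow0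
    rw [Real.log_mul (Real.exp_pos _).ne' (pow_pos hφpos _).ne', Real.log_exp, Real.log_pow] at h1
    have h2 : 8 * β * r ^ 2 * ((6 * M ^ 4 : ℕ) : ℝ) = 48 * Mr ^ 4 := by
      rw [hr2]; push_cast; rw [hMr]; field_simp; ring
    rw [h2] at h1
    have h3 : 3 * Real.log r - Real.log 600 ≤ Real.log φ := by
      have := Real.log_le_log (by positivity) hφ
      rwa [Real.log_div (by positivity) (by norm_num), Real.log_pow] at this
    have h4 : ((3 * M ^ 4 + M ^ 3 : ℕ) : ℝ) = 3 * Mr ^ 4 + Mr ^ 3 := by push_cast; rw [hMr]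
    rw [h4] at h1
    have h5 : (3 * Mr ^ 4 + Mr ^ 3) * (3 * Real.log r - Real.log 600) ≤ (3 * Mr ^ 4 + Mr ^ 3) * Real.log φ :=
      mul_le_mul_of_nonneg_left h3 (by positivity)
    linarith
  -- logarithms of `r` and `β/2`
  have hlogr : Real.log r = -(Real.log β) / 2 := by
    rw [hr, Real.log_sqrt (by positivity), one_div, Real.log_inv]
  have hlog2 : Real.log (β / 2) = Real.log β - Real.log 2 := Real.log_div hβ0.ne' (by norm_num)
  -- the mean action is `6M⁴` times the mean plaquette cost
  have hmean := wilsonExpectation_wilsonAction_eq_card_mul (d := 4) (L := M) (G := Matrix.specialUnitaryGroup (Fin 2) ℂ) ρ hρ β x hij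
  rw [card_plaquette_four] at hmean
  set E : ℝ := wilsonExpectation ρ β (fun U : GaugeConfig 4 M (Matrix.specialUnitaryGroup (Fin 2) ℂ) =>
    ((2 : ℕ) : ℝ) - (ρ (plaquetteHolonomy U x i j)).trace.re) with hE
  have hmean' : wilsonExpectation ρ β (wilsonAction (d := 4) (L := M) (G := Matrix.specialUnitaryGroup (Fin 2) ℂ) ρ) = 6 * Mr ^ 4 * E := by
    rw [hmean]; push_cast; rw [hMr]
  rw [hmean'] at hchord
  -- combine: `(β/2)·6M⁴·E ≤ 6M³ log β + 81 M⁴`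
  have hkey : β / 2 * (6 * Mr ^ 4 * E) ≤ 6 * Mr ^ 3 * Real.log β + 81 * Mr ^ 4 := by
    have h1 : β / 2 * (6 * Mr ^ 4 * E) ≤ Real.log (ZI (β / 2)) - Real.log (ZI β) := by
      have : (β - β / 2) = β / 2 := by ring
      rw [this] at hchord; exact hchord
    -- the difference of the two Laplace bounds, expanded
    have hsum : Real.log (ZI (β / 2)) - Real.log (ZI β) ≤
        3 * (Mr ^ 4 - Mr ^ 3) * (Real.log 3 - 3 / 2 * Real.log (β / 2)) -
          (-(48 * Mr ^ 4) + (3 * Mr ^ 4 + Mr ^ 3) * (3 * Real.log r - Real.log 600)) := by linarith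
    have hexp : 3 * (Mr ^ 4 - Mr ^ 3) * (Real.log 3 - 3 / 2 * Real.log (β / 2)) -
          (-(48 * Mr ^ 4) + (3 * Mr ^ 4 + Mr ^ 3) * (3 * Real.log r - Real.log 600)) =
        6 * Mr ^ 3 * Real.log β + (3 * (Mr ^ 4 - Mr ^ 3) * (Real.log 3 + 3 / 2 * Real.log 2) + 48 * Mr ^ 4 +
          (3 * Mr ^ 4 + Mr ^ 3) * Real.log 600) := by
      rw [hlog2, hlogr]; ring
    -- numerical bounds: `log 3 + (3/2) log 2 ≤ 61/25`, `log 600 ≤ 13/2`, `M³ ≤ M⁴/2`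
    have hl2 := Real.log_two_lt_d9
    have hl2' : 0 < Real.log 2 := Real.log_pos (by norm_num)
    have hl3' : 0 ≤ Real.log 3 := Real.log_nonneg (by norm_num)
    have hM3 : 2 * Mr ^ 3 ≤ Mr ^ 4 := by
      have h := mul_le_mul_of_nonneg_right hM1 (pow_pos hM0 3).le
      rwa [show Mr * Mr ^ 3 = Mr ^ 4 by ring] at h
    have hA : 3 * (Mr ^ 4 - Mr ^ 3) * (Real.log 3 + 3 / 2 * Real.log 2) ≤ 3 * (Mr ^ 4 * (61 / 25)) := by
      have h2 : Real.log 3 + 3 / 2 * Real.log 2 ≤ 61 / 25 := by linarith [log_three_le']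
      have h3 : 0 ≤ Real.log 3 + 3 / 2 * Real.log 2 := by linarith
      have h4 : Mr ^ 4 - Mr ^ 3 ≤ Mr ^ 4 := by linarith [pow_pos hM0 3]
      have h5 := mul_le_mul h4 h2 h3 (pow_pos hM0 4).le
      have h6 : 3 * (Mr ^ 4 - Mr ^ 3) * (Real.log 3 + 3 / 2 * Real.log 2) =
          3 * ((Mr ^ 4 - Mr ^ 3) * (Real.log 3 + 3 / 2 * Real.log 2)) := by ring
      rw [h6]
      linarith [h5]
    have hB : (3 * Mr ^ 4 + Mr ^ 3) * Real.log 600 ≤ 7 / 2 * Mr ^ 4 * (13 / 2) := by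
      have h2 : 3 * Mr ^ 4 + Mr ^ 3 ≤ 7 / 2 * Mr ^ 4 := by linarith [hM3]
      have h3 : 0 ≤ Real.log 600 := Real.log_nonneg (by norm_num)
      exact mul_le_mul h2 log_600_le h3 (by positivity)
    rw [hexp] at hsum
    have hM4 : 0 ≤ Mr ^ 4 := (pow_pos hM0 4).le
    linarith [h1, hsum, hA, hB, hM4]
  -- divide by `3βM⁴`
  have hMr0 : Mr ≠ 0 := hM0.ne'
  have hβne : β ≠ 0 := hβ0.ne'
  have hE : E ≤ (6 * Mr ^ 3 * Real.log β + 81 * Mr ^ 4) / (3 * β * Mr ^ 4) := by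
    rw [le_div_iff₀ (by positivity)]
    have e : E * (3 * β * Mr ^ 4) = β / 2 * (6 * Mr ^ 4 * E) := by ring
    rw [e]; exact hkey
  have hsplit : (6 * Mr ^ 3 * Real.log β + 81 * Mr ^ 4) / (3 * β * Mr ^ 4) = 27 / β + 2 * Real.log β / (Mr * β) := by
    field_simp
    ring
  rw [← hsplit]; exact hE

/-- **The crux letters.**  For every `β ≥ 2`, every odd torus `(ℤ/(2L+1))⁴` with `L ≥ 1`, orientation `q.1 < q.2` and site `x`:
`2 − 27/β − 2 log β/((2L+1)β) ≤ ⟨plane q x⟩_{2L+1,β}` (`SU(2)` fundamental). [folklore] -/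
theorem torusE_two_sub_plane_le_sharp {β : ℝ} (hβ : 2 ≤ β) {L : ℕ} (hL : 1 ≤ L) (q : Fin 4 × Fin 4) (hq : q.1 < q.2) (x : Fin 4 → ℤ) :
    2 - 27 / β - 2 * Real.log β / ((2 * L + 1 : ℕ) * β) ≤
      torusE (Matrix.specialUnitaryGroup (Fin 2) ℂ) (fundamentalLatticeRep 2) β L
        (plane (Matrix.specialUnitaryGroup (Fin 2) ℂ) (fundamentalLatticeRep 2) q x) := by
  haveI : Fact (1 < 2 * L + 1) := ⟨by omega⟩
  rw [torusE_plane_eq_wilsonExpectation]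
  have h := wilsonExpectation_two_sub_trace_le_su2 (M := 2 * L + 1) hβ
    (Literature.Probability.LatticeModels.Torus.proj (2 * L + 1) x) hq.ne
  -- linearity: `⟨2 − Re tr⟩ = 2 − ⟨Re tr⟩`
  haveI := isProbabilityMeasure_wilsonMeasure (d := 4) (L := 2 * L + 1) (G := Matrix.specialUnitaryGroup (Fin 2) ℂ)
    (fundamentalRep (Fin 2)) (continuous_fundamentalRep (Fin 2)) β
  have hcont : Continuous fun U : GaugeConfig 4 (2 * L + 1) (Matrix.specialUnitaryGroup (Fin 2) ℂ) =>
      (fundamentalRep (Fin 2) (plaquetteHolonomy U (Literature.Probability.LatticeModels.Torus.proj (2 * L + 1) x) q.1 q.2)).trace.re := by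
    refine Complex.continuous_re.comp (Continuous.matrix_trace ((continuous_fundamentalRep (Fin 2)).comp ?_))
    unfold plaquetteHolonomy; fun_prop
  have hbd : ∀ U : GaugeConfig 4 (2 * L + 1) (Matrix.specialUnitaryGroup (Fin 2) ℂ),
      |(fundamentalRep (Fin 2) (plaquetteHolonomy U (Literature.Probability.LatticeModels.Torus.proj (2 * L + 1) x) q.1 q.2)).trace.re| ≤ 2 := by
    intro U
    have := Literature.RepresentationTheory.CompactGroups.CompactGroup.abs_re_trace_le_card (fundamentalRep (Fin 2))
      (continuous_fundamentalRep (Fin 2)) (plaquetteHolonomy U (Literature.Probability.LatticeModels.Torus.proj (2 * L + 1) x) q.1 q.2)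
    simpa using this
  have hint : Integrable (fun U : GaugeConfig 4 (2 * L + 1) (Matrix.specialUnitaryGroup (Fin 2) ℂ) =>
      (fundamentalRep (Fin 2) (plaquetteHolonomy U (Literature.Probability.LatticeModels.Torus.proj (2 * L + 1) x) q.1 q.2)).trace.re)
      (wilsonMeasure (d := 4) (L := 2 * L + 1) (fundamentalRep (Fin 2)) β) :=
    Integrable.of_bound hcont.measurable.aestronglyMeasurable 2 (ae_of_all _ fun U => by rw [Real.norm_eq_abs]; exact hbd U)
  have hlin : wilsonExpectation (d := 4) (L := 2 * L + 1) (fundamentalRep (Fin 2)) β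
      (fun U : GaugeConfig 4 (2 * L + 1) (Matrix.specialUnitaryGroup (Fin 2) ℂ) =>
        ((2 : ℕ) : ℝ) - (fundamentalRep (Fin 2) (plaquetteHolonomy U (Literature.Probability.LatticeModels.Torus.proj (2 * L + 1) x) q.1 q.2)).trace.re) =
      2 - wilsonExpectation (d := 4) (L := 2 * L + 1) (fundamentalRep (Fin 2)) β
      (fun U => (fundamentalRep (Fin 2) (plaquetteHolonomy U (Literature.Probability.LatticeModels.Torus.proj (2 * L + 1) x) q.1 q.2)).trace.re) := by
    unfold wilsonExpectation
    rw [integral_sub (integrable_const _) hint, integral_const, smul_eq_mul, probReal_univ, one_mul]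
    norm_num
  rw [hlin] at h
  linarith

/-- **On every odd torus of side at least `log β`**: for `β ≥ 2`, `L ≥ 1` with `log β ≤ 2L+1`, `q.1 < q.2`, `x`:
`2 − 29/β ≤ ⟨plane q x⟩_{2L+1,β}` — the torus thermal ceiling `⟨2 − Re tr U_p⟩ ≤ 29/β` WITHOUT THE LOG, uniformly on all such volumes. [folklore] -/
theorem torusE_two_sub_plane_le_of_log_le {β : ℝ} (hβ : 2 ≤ β) {L : ℕ} (hL : 1 ≤ L) (hlog : Real.log β ≤ (2 * L + 1 : ℕ))
    (q : Fin 4 × Fin 4) (hq : q.1 < q.2) (x : Fin 4 → ℤ) :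
    2 - 29 / β ≤
      torusE (Matrix.specialUnitaryGroup (Fin 2) ℂ) (fundamentalLatticeRep 2) β L
        (plane (Matrix.specialUnitaryGroup (Fin 2) ℂ) (fundamentalLatticeRep 2) q x) := by
  have h := torusE_two_sub_plane_le_sharp hβ hL q hq x
  have hβ0 : 0 < β := by linarith
  have hN : (0 : ℝ) < (2 * L + 1 : ℕ) := by positivity
  have hres : 2 * Real.log β / ((2 * L + 1 : ℕ) * β) ≤ 2 / β := by
    rw [div_le_div_iff₀ (by positivity) hβ0]
    have := mul_le_mul_of_nonneg_right hlog hβ0.le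
    nlinarith
  have : 27 / β + 2 / β = 29 / β := by ring
  linarith

end Ceiling


end Summit.QuantumFields.YangMills.Cruxes.UVSeamRec.ClassicalResponse.ThermalFloor

end
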